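import Summits.QuantumFields.YangMills.Theorems.SoloBlindSpacingPinning
import HarnessLib

/-!
# Spacing pinning on the scheme's own tori (solo-QuantumFields-blind, rung D19 — the reach of
# rung D18 corrected)

`Summit.QuantumFields.YangMills.Theorems.SoloBlindSchemeTorusPinning` (read-only conjunct
`YangMills`).  Rung D18 (`SoloBlindSpacingPinning`) typed the analytic input of reading (R2′) as
`HasPhysicalRatioFloor`: a ratio floor for the statement's correlator at two lattice times of
physical separation `≥ τ`, holding on EVERY torus `S ≥ L_k`, eventually in `k`.  That uniformity in
`S` is NOT available from the statement: `IsYangMillsFor r sch T` asserts convergence of the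
renormalised lattice `n`-point functions on the scheme's OWN tori only — `latticeSchwinger` is an
integral against `wilsonMeasure (L := sch.side k)`, one torus `(ℤ/(2L_k+1))⁴` per `k` — while the
lattice-gap conjunct `HasLatticeMassGap` speaks about all `S ≥ L_k`.  The two meet on exactly one
torus per `k`.  This file redoes D18 there, for a `k`-DEPENDENT family of time-zero spatial
observables `A k` (the shape a spatially smeared field has), and separates what survives
unconditionally from what needs a growth condition on the witness data:

* `schemeCorr r sch A k n` — the statement's correlator `c_k(n) := c_{A_k A_k}(L_k; n)` of `A k` on
  the `k`-th torus at `β_k`; `HasRatioFloorOnSchemeTori r sch A τ ϑ` — lattice times `n₁ k < n₂ k`,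
  `a_k (n₂ k − n₁ k) ≥ τ`, `a_k n₂ k ≤ t₂`, and eventually in `k`: `c_k(n₂ k) > 0` and
  `ϑ c_k(n₁ k) ≤ c_k(n₂ k)` — on the scheme's tori only (what convergence at two physical times to
  a limit positive at the later time gives; the RATIO is free of the species renormalisation
  `c_s(k)`, which cancels);
* `schemeTori_oneStep_ratio`, `schemeTori_lower_envelope` — UNCONDITIONAL (`β_k → ∞`, `0 < τ`,
  `0 < ϑ ≤ 1`, `κ := −log ϑ/τ`): eventually in `k`, `e^{−κ a_k} c_k(q) ≤ c_k(q+1)` for every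
  `n₂ k ≤ q < 2L_k+1`, hence `c_k(n₂ k) e^{−κ a_k (n − n₂ k)} ≤ c_k(n)` on `n₂ k ≤ n ≤ 2L_k+1`: on
  its own torus at `β_k` the lattice theory has correlation length `≥ 1/(κ a_k) → ∞` in the slope
  sense — per lattice step the correlator of `A k` loses at most the factor `e^{−κ a_k}`.  This is
  the renormalisation-free content of (R2′);
* `gap_le_of_schemeToriFloor` — CONDITIONAL: if in addition the antipodal value obeys a gap bound
  `c_k(L_k) ≤ C_k e^{−Δ a_k L_k}` whose constant exceeds the floor VALUE by at most a factor
  sub-exponential in the physical volume, `C_k ≤ c_k(n₂ k) e^{ε a_k L_k}` eventually for every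
  `ε > 0`, then `Δ ≤ κ`; `latticeMassGap_le_of_schemeToriFloor` — the fixed-species case fed by
  `HasLatticeMassGap r sch Δ` (constant `C`), where the condition reads: the floor `c_k(n₂ k)` is
  `e^{−o(a_k L_k)}`.

Why a condition is unavoidable on one torus per `k`: the floor VALUE `c_k(n₂ k)` carries the factor
`1/c_s(k)²` of the witness's free multiplicative renormalisation (only its ratio content is pinned
by convergence), and the torus has physical extent `a_k L_k → ∞` at an unprescribed rate, so a
comparison of VALUES at the antipode is informative only when `log(C_k / c_k(n₂ k)) = o(a_k L_k)`;
D18's `S`-uniform floor let `S → ∞` at fixed `k` instead, which the statement does not license.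
Likewise the D18 conclusion `¬ ClustersAtRate r (β_k) A A m₀` (a statement about all large tori at
`β_k`) has no analogue from one torus per `k`.  Structure only: reflection positivity on odd tori
(rung D8) and the discrete lemmas of D18; everything here holds verbatim for `U(1)`; no claim on
IR-1. [this unit's; mechanism folklore: OS positivity ⇒ log-convexity ⇒ monotone one-step ratios]
-/

open MeasureTheory Filter Topology
open Literature.MathematicalPhysics.QuantumFieldTheory Literature.MathematicalPhysics.QuantumLattice

noncomputable section

namespace Summit.QuantumFields.YangMills.Theorems.SoloBlind

variable {G : Type} [Group G] [TopologicalSpace G] [IsTopologicalGroup G] [CompactSpace G]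
  [MeasurableSpace G] [BorelSpace G]

/-- **The statement's correlator on the scheme's own torus**: `c_k(n) := c_{A_k, A_k}(L_k; n)`, the
connected time-correlation of the `k`-th observable of the family `A` on the `k`-th torus
`(ℤ/(2L_k+1))⁴` at the scheme's coupling `β_k` — the only tori about which `IsYangMillsFor` says
anything. [this unit's] -/
def schemeCorr (r : LatticeRep G) (sch : SpeciesScheme (YMSpecies G)) (A : ℕ → YMSpecies G)
    (k n : ℕ) : ℝ :=
  latticeConnectedCorr r.ρ (sch.β k) (2 * sch.L k + 1) (A k).F (A k).F n

/-- **Ratio floor on the scheme's own tori** for a family `A : ℕ → YMSpecies G`, physical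
separation `τ`, ratio `ϑ`: lattice times `n₁ k < n₂ k` with `a_k (n₂ k − n₁ k) ≥ τ` and
`a_k n₂ k ≤ t₂`, such that eventually in `k` the `k`-th correlator on the `k`-th torus satisfies
`c_k(n₂ k) > 0` and `ϑ · c_k(n₁ k) ≤ c_k(n₂ k)`.  (Intended source: `IsYangMillsFor` at two physical
times `t₁ < t₂` + `IsNontrivial`, for the spatially smeared curvature field `A k`; the ratio is
independent of the multiplicative renormalisation.) [this unit's] -/
def HasRatioFloorOnSchemeTori (r : LatticeRep G) (sch : SpeciesScheme (YMSpecies G))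
    (A : ℕ → YMSpecies G) (τ ϑ : ℝ) : Prop :=
  ∃ n₁ n₂ : ℕ → ℕ, ∃ t₂ : ℝ, (∀ k, n₁ k < n₂ k) ∧ (∀ k, τ ≤ sch.a k * ((n₂ k - n₁ k : ℕ) : ℝ)) ∧
    (∀ k, sch.a k * n₂ k ≤ t₂) ∧
    ∀ᶠ k in atTop, 0 < schemeCorr r sch A k (n₂ k) ∧
      ϑ * schemeCorr r sch A k (n₁ k) ≤ schemeCorr r sch A k (n₂ k)

/-- **One-step ratio floor on the scheme's own tori (unconditional).**  `A k` time-zero spatial for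
every `k`, `β_k → ∞`, `0 < τ`, `0 < ϑ ≤ 1`, lattice times `n₁ k < n₂ k` with `a_k (n₂ k − n₁ k) ≥ τ`
and the ratio floor `ϑ c_k(n₁ k) ≤ c_k(n₂ k)` eventually in `k`.  Then, with `κ := −log ϑ / τ`,
eventually in `k`: `e^{−κ a_k} · c_k(q) ≤ c_k(q+1)` for all `n₂ k ≤ q`, `q + 1 ≤ 2L_k + 1` — beyond
the physical time `t₂` the correlator of `A k` on its own torus loses at most the factor `e^{−κ a_k}`
per lattice step (log-convexity round the odd torus, rung D8, and `mulConvex_ratio_floor`, D18).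
[this unit's] -/
theorem schemeTori_oneStep_ratio (r : LatticeRep G) {sch : SpeciesScheme (YMSpecies G)}
    (hw : sch.HasWeakCouplingLimit) (A : ℕ → YMSpecies G) (hA : ∀ k, IsTimeZeroSpatial (A k))
    {τ ϑ : ℝ} (hτ : 0 < τ) (hϑ : 0 < ϑ) (hϑ1 : ϑ ≤ 1) {n₁ n₂ : ℕ → ℕ}
    (h12 : ∀ k, n₁ k < n₂ k) (hsep : ∀ k, τ ≤ sch.a k * ((n₂ k - n₁ k : ℕ) : ℝ))
    (hfl : ∀ᶠ k in atTop, ϑ * schemeCorr r sch A k (n₁ k) ≤ schemeCorr r sch A k (n₂ k)) :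
    ∀ᶠ k in atTop, ∀ q : ℕ, n₂ k ≤ q → q + 1 ≤ 2 * sch.L k + 1 →
      Real.exp (-(-Real.log ϑ / τ * sch.a k)) * schemeCorr r sch A k q ≤
        schemeCorr r sch A k (q + 1) := by
  have hρ := r.continuous
  set κ : ℝ := -Real.log ϑ / τ with hκ
  have hκ0 : 0 ≤ κ := div_nonneg (neg_nonneg.mpr (Real.log_nonpos hϑ.le hϑ1)) hτ.le
  have hβ0 : ∀ᶠ k in atTop, 0 ≤ sch.β k := hw.eventually_ge_atTop 0
  filter_upwards [hfl, hβ0, eventually_one_le_L sch] with k hratio hβ hL1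
  intro q hq hqK
  -- per-step floor `θ = e^{-κ a_k}`; `θ^{n₂-n₁} ≤ ϑ` because `a_k (n₂-n₁) ≥ τ`
  set θ : ℝ := Real.exp (-(κ * sch.a k)) with hθ
  have hθpos : 0 < θ := Real.exp_pos _
  have hθpow : ∀ j : ℕ, θ ^ j = Real.exp (-(κ * (sch.a k * (j : ℝ)))) := fun j => by
    rw [hθ, ← Real.exp_nat_mul]; ring_nf
  have hθd : θ ^ (n₂ k - n₁ k) ≤ ϑ := by
    rw [hθpow]
    calc Real.exp (-(κ * (sch.a k * ((n₂ k - n₁ k : ℕ) : ℝ))))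
          ≤ Real.exp (-(κ * τ)) := Real.exp_le_exp.mpr (by nlinarith [hsep k])
      _ = ϑ := by
          rw [hκ, div_mul_cancel₀ _ hτ.ne', neg_neg, Real.exp_log hϑ]
  set c : ℕ → ℝ := fun j => schemeCorr r sch A k j with hc
  have hc0' : ∀ j, 0 ≤ c j := fun j =>
    latticeConnectedCorr_self_nonneg r.ρ hρ hβ hL1 (A k) (hA k) j
  have hc0 : ∀ j, j ≤ 2 * sch.L k + 1 → 0 ≤ c j := fun j _ => hc0' j
  have hcconv : ∀ j, j + 2 ≤ 2 * sch.L k + 1 → c (j + 1) ^ 2 ≤ c j * c (j + 2) := fun j hj =>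
    latticeConnectedCorr_self_logConvex r.ρ hρ hβ hL1 (A k) (hA k) j hj
  have hfloor : θ ^ (n₂ k - n₁ k) * c (n₁ k) ≤ c (n₂ k) :=
    (mul_le_mul_of_nonneg_right hθd (hc0' _)).trans hratio
  exact mulConvex_ratio_floor hc0 hcconv hθpos (h12 k) hfloor q hq hqK

/-- **Lower envelope on the scheme's own tori (unconditional).**  Under the hypotheses of
`schemeTori_oneStep_ratio`: eventually in `k`, `c_k(n₂ k) · e^{−κ a_k (n − n₂ k)} ≤ c_k(n)` for every
`n₂ k ≤ n ≤ 2L_k + 1`, `κ = −log ϑ / τ` — on its own torus at `β_k` the lattice theory has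
correlation length `≥ 1/(κ a_k) → ∞` in the slope sense.  No renormalisation constant enters.
[this unit's] -/
theorem schemeTori_lower_envelope (r : LatticeRep G) {sch : SpeciesScheme (YMSpecies G)}
    (hw : sch.HasWeakCouplingLimit) (A : ℕ → YMSpecies G) (hA : ∀ k, IsTimeZeroSpatial (A k))
    {τ ϑ : ℝ} (hτ : 0 < τ) (hϑ : 0 < ϑ) (hϑ1 : ϑ ≤ 1) {n₁ n₂ : ℕ → ℕ}
    (h12 : ∀ k, n₁ k < n₂ k) (hsep : ∀ k, τ ≤ sch.a k * ((n₂ k - n₁ k : ℕ) : ℝ))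
    (hfl : ∀ᶠ k in atTop, ϑ * schemeCorr r sch A k (n₁ k) ≤ schemeCorr r sch A k (n₂ k)) :
    ∀ᶠ k in atTop, ∀ n : ℕ, n₂ k ≤ n → n ≤ 2 * sch.L k + 1 →
      schemeCorr r sch A k (n₂ k) *
          Real.exp (-(-Real.log ϑ / τ * (sch.a k * ((n - n₂ k : ℕ) : ℝ)))) ≤
        schemeCorr r sch A k n := by
  set κ : ℝ := -Real.log ϑ / τ with hκ
  filter_upwards [schemeTori_oneStep_ratio r hw A hA hτ hϑ hϑ1 h12 hsep hfl] with k hk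
  intro n hn hnK
  have henv := mulConvex_lower_envelope (a := fun j => schemeCorr r sch A k j)
    (Real.exp_pos (-(κ * sch.a k))).le hk n hn hnK
  have hθpow : Real.exp (-(κ * sch.a k)) ^ (n - n₂ k) =
      Real.exp (-(κ * (sch.a k * ((n - n₂ k : ℕ) : ℝ)))) := by
    rw [← Real.exp_nat_mul]; ring_nf
  calc schemeCorr r sch A k (n₂ k) * Real.exp (-(κ * (sch.a k * ((n - n₂ k : ℕ) : ℝ))))
        = Real.exp (-(κ * sch.a k)) ^ (n - n₂ k) * schemeCorr r sch A k (n₂ k) := by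
          rw [hθpow, mul_comm]
    _ ≤ schemeCorr r sch A k n := henv

/-- **Packaged form.**  `HasRatioFloorOnSchemeTori r sch A τ ϑ` (with `A k` time-zero spatial,
`β_k → ∞`, `0 < τ`, `0 < ϑ ≤ 1`) yields lattice times `n₂ k` of bounded physical time `a_k n₂ k ≤ t₂`
at which, eventually in `k`, the correlator is positive and from which it decays no faster than
`e^{−κ a_k}` per step up to the antipode and beyond (`n ≤ 2L_k+1`), `κ = −log ϑ / τ`. [this unit's] -/
theorem lower_envelope_of_hasRatioFloorOnSchemeTori (r : LatticeRep G)
    {sch : SpeciesScheme (YMSpecies G)} (hw : sch.HasWeakCouplingLimit) (A : ℕ → YMSpecies G)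
    (hA : ∀ k, IsTimeZeroSpatial (A k)) {τ ϑ : ℝ} (hτ : 0 < τ) (hϑ : 0 < ϑ) (hϑ1 : ϑ ≤ 1)
    (hfl : HasRatioFloorOnSchemeTori r sch A τ ϑ) :
    ∃ n₂ : ℕ → ℕ, ∃ t₂ : ℝ, (∀ k, sch.a k * n₂ k ≤ t₂) ∧
      ∀ᶠ k in atTop, 0 < schemeCorr r sch A k (n₂ k) ∧ ∀ n : ℕ, n₂ k ≤ n → n ≤ 2 * sch.L k + 1 →
        schemeCorr r sch A k (n₂ k) *
            Real.exp (-(-Real.log ϑ / τ * (sch.a k * ((n - n₂ k : ℕ) : ℝ)))) ≤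
          schemeCorr r sch A k n := by
  obtain ⟨n₁, n₂, t₂, h12, hsep, ht₂, hev⟩ := hfl
  refine ⟨n₂, t₂, ht₂, ?_⟩
  filter_upwards [hev, schemeTori_lower_envelope r hw A hA hτ hϑ hϑ1 h12 hsep
    (hev.mono fun k hk => hk.2)] with k hk henv
  exact ⟨hk.1, henv⟩

/-- **The gap bound on the scheme's own tori, under a growth condition (conditional).**  Under the
hypotheses of `schemeTori_oneStep_ratio`, with `a_k n₂ k ≤ t₂` and the floor `c_k(n₂ k) > 0`
eventually: suppose the antipodal value obeys a gap bound `c_k(L_k) ≤ C_k e^{−Δ a_k L_k}` eventually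
in `k`, with constants exceeding the floor VALUE by at most a factor sub-exponential in the physical
volume — for every `ε > 0`, `C_k ≤ c_k(n₂ k) · e^{ε a_k L_k}` eventually in `k`.  Then
`Δ ≤ κ = −log ϑ / τ`.  (At the antipode `c_k(n₂ k) e^{−κ a_k (L_k − n₂ k)} ≤ C_k e^{−Δ a_k L_k}`;
the condition is what makes this comparison of values informative on a torus of physical extent
`a_k L_k`, whose growth the statement does not prescribe.) [this unit's] -/
theorem gap_le_of_schemeToriFloor (r : LatticeRep G) {sch : SpeciesScheme (YMSpecies G)}
    (hw : sch.HasWeakCouplingLimit) (A : ℕ → YMSpecies G) (hA : ∀ k, IsTimeZeroSpatial (A k))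
    {τ ϑ : ℝ} (hτ : 0 < τ) (hϑ : 0 < ϑ) (hϑ1 : ϑ ≤ 1) {n₁ n₂ : ℕ → ℕ} {t₂ : ℝ}
    (h12 : ∀ k, n₁ k < n₂ k) (hsep : ∀ k, τ ≤ sch.a k * ((n₂ k - n₁ k : ℕ) : ℝ))
    (ht₂ : ∀ k, sch.a k * n₂ k ≤ t₂)
    (hfl : ∀ᶠ k in atTop, 0 < schemeCorr r sch A k (n₂ k) ∧
      ϑ * schemeCorr r sch A k (n₁ k) ≤ schemeCorr r sch A k (n₂ k))
    {Δ : ℝ} {C : ℕ → ℝ}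
    (hup : ∀ᶠ k in atTop, schemeCorr r sch A k (sch.L k) ≤
      C k * Real.exp (-(Δ * (sch.a k * sch.L k))))
    (htame : ∀ ε : ℝ, 0 < ε → ∀ᶠ k in atTop,
      C k ≤ schemeCorr r sch A k (n₂ k) * Real.exp (ε * (sch.a k * sch.L k))) :
    Δ ≤ -Real.log ϑ / τ := by
  set κ : ℝ := -Real.log ϑ / τ with hκ
  have hκ0 : 0 ≤ κ := div_nonneg (neg_nonneg.mpr (Real.log_nonpos hϑ.le hϑ1)) hτ.le
  refine le_of_forall_pos_le_add fun ε hε => ?_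
  have henv := schemeTori_lower_envelope r hw A hA hτ hϑ hϑ1 h12 hsep (hfl.mono fun k hk => hk.2)
  have hvol : ∀ᶠ k in atTop, 0 < sch.a k * sch.L k := sch.tendsto_L.eventually_gt_atTop 0
  obtain ⟨k, hk_env, hk_fl, hk_up, hk_tame, hk_vol, hn₂L⟩ :=
    (henv.and (hfl.and (hup.and ((htame ε hε).and (hvol.and
      (eventually_lt_L_of_bounded_time sch ht₂)))))).exists
  set a : ℝ := sch.a k with ha
  set L : ℕ := sch.L k with hL
  set c₂ : ℝ := schemeCorr r sch A k (n₂ k) with hc₂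
  have hc₂pos : 0 < c₂ := hk_fl.1
  have h1 : c₂ * Real.exp (-(κ * (a * ((L - n₂ k : ℕ) : ℝ)))) ≤ schemeCorr r sch A k L :=
    hk_env L hn₂L.le (by omega)
  have h2 : schemeCorr r sch A k L ≤ c₂ * Real.exp (ε * (a * L)) * Real.exp (-(Δ * (a * L))) :=
    hk_up.trans (mul_le_mul_of_nonneg_right hk_tame (Real.exp_pos _).le)
  have h3 : Real.exp (-(κ * (a * ((L - n₂ k : ℕ) : ℝ)))) ≤
      Real.exp (ε * (a * L)) * Real.exp (-(Δ * (a * L))) := by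
    have h12' := h1.trans h2
    rw [mul_assoc] at h12'
    exact le_of_mul_le_mul_left h12' hc₂pos
  rw [← Real.exp_add, Real.exp_le_exp] at h3
  have hcast : ((L - n₂ k : ℕ) : ℝ) = (L : ℝ) - n₂ k := by
    push_cast [Nat.cast_sub hn₂L.le]; ring
  rw [hcast] at h3
  have hexpand : κ * (a * ((L : ℝ) - n₂ k)) = κ * (a * L) - κ * (a * n₂ k) := by ring
  rw [hexpand] at h3
  have hn₂0 : 0 ≤ κ * (a * n₂ k) := mul_nonneg hκ0 (mul_nonneg (sch.a_pos k).le (Nat.cast_nonneg _))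
  have h4 : Δ * (a * L) ≤ (κ + ε) * (a * L) := by
    rw [add_mul]; linarith
  exact le_of_mul_le_mul_right h4 hk_vol

/-- **Fixed species, fed by the lattice-gap conjunct.**  Let `A₀` be a time-zero spatial species
with a ratio floor on the scheme's own tori (`β_k → ∞`, `0 < τ`, `0 < ϑ ≤ 1`, lattice times as in
`HasRatioFloorOnSchemeTori`) whose floor VALUE is not exponentially small in the physical volume:
`c_k(n₂ k) · e^{ε a_k L_k} → ∞` for every `ε > 0`.  Then `HasLatticeMassGap r sch Δ` forces
`Δ ≤ −log ϑ / τ`.  This is what replaces rung D18's `latticeMassGap_le_of_ratioFloor` once the floor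
is asked only where `IsYangMillsFor` can supply it; the growth condition is the price of comparing
values on one torus per `k`. [this unit's] -/
theorem latticeMassGap_le_of_schemeToriFloor (r : LatticeRep G)
    {sch : SpeciesScheme (YMSpecies G)} (hw : sch.HasWeakCouplingLimit) {Δ : ℝ}
    (hgap : HasLatticeMassGap r sch Δ) (A₀ : YMSpecies G) (hA : IsTimeZeroSpatial A₀) {τ ϑ : ℝ}
    (hτ : 0 < τ) (hϑ : 0 < ϑ) (hϑ1 : ϑ ≤ 1) {n₁ n₂ : ℕ → ℕ} {t₂ : ℝ}
    (h12 : ∀ k, n₁ k < n₂ k) (hsep : ∀ k, τ ≤ sch.a k * ((n₂ k - n₁ k : ℕ) : ℝ))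
    (ht₂ : ∀ k, sch.a k * n₂ k ≤ t₂)
    (hfl : ∀ᶠ k in atTop, 0 < schemeCorr r sch (fun _ => A₀) k (n₂ k) ∧
      ϑ * schemeCorr r sch (fun _ => A₀) k (n₁ k) ≤ schemeCorr r sch (fun _ => A₀) k (n₂ k))
    (hgrow : ∀ ε : ℝ, 0 < ε → Tendsto
      (fun k => schemeCorr r sch (fun _ => A₀) k (n₂ k) * Real.exp (ε * (sch.a k * sch.L k)))
      atTop atTop) :
    Δ ≤ -Real.log ϑ / τ := by
  obtain ⟨C, hC⟩ := hgap A₀ A₀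
  refine gap_le_of_schemeToriFloor r hw (fun _ => A₀) (fun _ => hA) hτ hϑ hϑ1 h12 hsep ht₂ hfl
    (C := fun _ => C) ?_ ?_
  · filter_upwards [hC] with k hk
    exact (le_abs_self _).trans (hk (sch.L k) le_rfl (sch.L k) le_rfl)
  · intro ε hε
    exact (hgrow ε hε).eventually_ge_atTop C

end Summit.QuantumFields.YangMills.Theorems.SoloBlind

end
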